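import Mathlib
import HarnessLib
import HarnessLib.Audit
import Summits.HodgeConjecture.Statement
import Literature.AlgebraicGeometry.Hyperkaehler.K3HilbertType
import Literature.AlgebraicGeometry.HodgeTheory.ChernCharacterBetti
import Literature.AlgebraicGeometry.HodgeTheory.RationalHodgeClasses
import Literature.AlgebraicTopology.SingularHomology.CupProduct
import Literature.AlgebraicGeometry.Motives.SegreEmbedding
import HarnessLib.Audit.Status.Attr

/-!
Route: MarkmanPartnerTransport

# Route MarkmanPartnerTransport — K3-partner transport — Hodge for projective K3^[2]-type fourfolds
via Markman isometries and K3 squares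

It suffices to show X = K3Sq2TypeHodge — the (rational) Hodge conjecture `HodgeConjectureFor 4 X`
for every smooth projective fourfold X of K3^[2]-type, rendered on a Beauville–Bogomolov marking (φ,
P, z) by the clauses (m1)–(m6) of the tree's marked Markman fact — TOGETHER WITH the remainder of
the summit, claimed as the declared residual crux SectorComplement (every other smooth projective
variety; summit-strength by design, exempt from T3/T4). X is attacked through the END_Hdg(T(X))
TRICHOTOMY (Zarhin: E := End_Hdg T(X) is ℚ, a CM field, or a totally real field ≠ ℚ): (i) E spanned
over ℚ by Hodge ISOMETRIES (the ℚ and CM thirds) ⇒ HC(X) by Markman's algebraic isometries and H⁴ =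
Sym² H² (IsometrySpannedThird); (ii) real multiplication with ρ(X) ≥ 4 ⇒ a projective K3 PARTNER S
with T(S)_ℚ ≅ T(X)_ℚ Hodge-isometrically and ρ(S) = ρ(X) − 1 ≥ 3 exists (PartnerExistence, lattice
theory + surjectivity of K3 periods) and Markman's algebraic isometry H²(S^[2]) ⥲ H²(X) TRANSPORTS
HC from S × S to X (PartnerTransport), so this third IS the K3-square problem HC(S × S), ρ(S) ≥ 3
(PicardThreeK3Squares); (iii) real multiplication with ρ(X) ≤ 3 is the partner-free residue
(LowPicardRealMultiplication). No ledger card (markdown cell hodge-nonav; memos ROUTE-P1C §13 and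
ROUTE-P1D §3, referee PASS 2026-08-25).
Lean: `open Literature.AlgebraicGeometry Literature.AlgebraicGeometry.Motives
Literature.AlgebraicGeometry.HodgeTheory Literature.AlgebraicGeometry.Hyperkaehler
Literature.AlgebraicGeometry.Surfaces Literature.AlgebraicTopology.SingularHomology CategoryTheory
in let MarkedK3Sq := fun (X : SchemeOver ℂ) (φ : complexBetti X 2 ≃ₗ[ℂ] (K3HilbertIndex → ℂ)) (P :
complexBetti X (2 * 4)) (z : K3HilbertIndex → ℂ) => ((IsIntegralClass P ∧ ∀ Q : complexBetti X (2 *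
4), IsIntegralClass Q → ∃ n : ℤ, Q = n • P) ∧ (∀ c : complexBetti X 2, IsIntegralClass c ↔ ∃ v :
K3HilbertIndex → ℤ, φ c = fun i => (v i : ℂ)) ∧ (∀ a : complexBetti X 2, cupPowTwo a 4 = ((3 : ℂ) *
(k3HilbertForm 2 (φ a) (φ a)) ^ 2) • P) ∧ (IsOfHodgeType 4 X 2 2 0 (LinearEquiv.symm φ z) ∧ ∀ τ :
complexBetti X 2, IsOfHodgeType 4 X 2 2 0 τ → ∃ t : ℂ, τ = t • LinearEquiv.symm φ z) ∧ (∀ c :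
complexBetti X 2, IsOfHodgeType 4 X 2 1 1 c ↔ (k3HilbertForm 2 (φ c) z = 0 ∧ k3HilbertForm 2 (φ c)
(star z) = 0)) ∧ (k3HilbertForm 2 z z = 0 ∧ 0 < (k3HilbertForm 2 (star z) z).re)); ∀ (X : SchemeOver
ℂ), IsSmoothProjective 4 X → IsOfK3HilbertSquareType X → ∀ (φ : complexBetti X 2 ≃ₗ[ℂ]
(K3HilbertIndex → ℂ)) (P : complexBetti X (2 * 4)) (z : K3HilbertIndex → ℂ), MarkedK3Sq X φ P z →
HodgeConjectureFor 4 X`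

## Assembly
Pure logic (sorry-free, `closes` in glue.lean / Sketch.lean, farm rc 0): SectorComplement reduces
the summit to the target; given marked X, case on the isometry-spanning hypothesis of
IsometrySpannedThird (yes ⇒ HC X); else case on 4 ≤ ρ(X) (yes ⇒ PartnerExistence gives (S, η, p, x,
g) with ρ(S) ≥ 3, PicardThreeK3Squares gives HC(S ⊗ S), PartnerTransport gives HC X); else ρ(X) ≤ 3
(omega) and LowPicardRealMultiplication gives HC X. Every binder of `closes` is consumed; the frame
item Assembly records the implication and is proved by the same term.

Rationale: WHY THIS LINE. Mechanism: Markman2024 (arXiv:2204.00516; tree fact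
`Literature.AlgebraicGeometry.Hyperkaehler.Markman2024_rationalHodgeIsometry_algebraic_marked`)
makes every rational Hodge isometry H²(X,ℚ) ⥲ H²(Y,ℚ) between projective K3^[2]-type fourfolds the
action of an algebraic class on Y × X; with Verbitsky–Guan H⁴(X,ℚ) = Sym² H²(X,ℚ)
(arXiv:alg-geom/9501001) the rational (2,2)-classes of X are Sym² NS(X), (NS ⊗ T)^{Hdg} = 0 and the
graphs t_e of self-adjoint e ∈ E = End_Hdg T(X), so HC(X) is exactly «every t_e is algebraic», and
t_e can be MOVED: from X's own isometries when they span E (ℚ: ±1 and reflections' products; CM: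
unitary elements span, tree theorem
`Literature.HodgeStructure.span_setOf_isometry_eq_top_of_conj_ne`), or from a K3 surface S whose
transcendental lattice is rationally Hodge-isometric to T(X), through S^[2] (Beauville1983
incidence, tree fact `Beauville1983_hilbertSquare_markedIncidence`) and Markman's isometry both
ways. Imported areas: hyperholomorphic-sheaf deformation theory (Markman, via the vendored fact),
lattice arithmetic (Witt cancellation, Hasse–Minkowski: T(X)_ℚ ↪ Λ_K3 ⊗ ℚ iff ρ(X) ≥ 4 leaves a
complement of dimension ≥ 3) and the surjectivity of K3 periods (Huybrechts2016K3 Ch. 6–7; tree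
`Surfaces.K3PeriodSurjectivity`) to BUILD the partner, Zarhin1983HodgeGroupsK3 for the trichotomy.
What it does that prior routes do not: NikulinTwinTransport and ELineTransport move classes between
K3 SQUARES along K3 isogenies (Buskin2019) and never leave the K3-square sector;
LinearSystemTorelli's fourfold crux asks divisor-supported middle cohomology, which hyper-Kählers
violate (h^{2,0} = 1); EvenB2Twistor / KugaSatakeDescent (retired not-a-thesis) stopped at
intermediate targets. This line takes a genuinely NON-K3-square sector (all projective deformations
of K3^[2]: Fano varieties of lines of cubic fourfolds, double EPW sextics, Debarre–Voisin fourfolds,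
moduli of sheaves on K3s) and reduces it, by one deciding theorem, to the K3-square problem at
Picard rank ≥ 3 plus one explicit residue — every theorem about HC(S × S) (Buskin CM, the kernel
theorem for E = ℚ, Varesco2025 at ρ = 16, Schlickewei2010, the live items
NikulinTwinTransport.SquareHodgeOfSqrtTwo / ELineTransport.RMSquares) becomes a theorem about
K3^[2]-type fourfolds. The negatives index (6 entries) contains no statement about hyper-Kähler
transport; ELineTransport.ELineConnectivity (refuted, lattice E-lines) is not used.

RANKED CRUXES. REV 4 (tenure g12, 2026-08-27, after p485393/p467836): #2 PartnerTransport and #3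
IsometrySpannedThird are re-badged SUPPORT (fact-reducible, every input a tree theorem or named
fact; they stay binders of `closes`); the OPEN CRUXES are #4 PicardThreeK3Squares (in effect the
rank-2 crux: the K3-square real-multiplication core at ρ(S) ≥ 3), #5 LowPicardRealMultiplication
(the partner-free residue) and the declared residual #6 SectorComplement. #0 K3Sq2TypeHodge (target)
— the Hodge conjecture (rational; `HodgeConjectureFor 4 X`) for every smooth projective fourfold X
of K3^[2]-type carrying a marking (φ, P, z) with Markman's clauses (m1)–(m6) (integral generator P
of H⁸, integral lattice read through φ : H²(X(ℂ);ℂ) ≃ ℂ^{Λ_K3 ⊕ ⟨−2⟩}, Fujiki relation a⁴ = 3 q(a)²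
P, period z spanning H^{2,0}, H^{1,1} = ⟨z, z̄⟩^⊥, q(z) = 0 < q(z̄, z)); VERBATIM the cell's
`HodgeNonAV.HC_K3Sq2Type_marked` (ROUTE-P1D-Sketch §13). (why it might fail: HC for K3^[n]-type is
OPEN in print: the (2,2)-classes t_e, e a real-multiplication endomorphism of T(X), have no known
algebraic source; a very general RM Noether–Lefschetz member with ρ(X) ≤ 3 is the counterexample
candidate (no partner, no isometries).) [Markman2024, arXiv:alg-geom/9501001, Huybrechts2016K3,
arXiv:2407.19488]
#2 PartnerTransport (support since rev 4: FACT-REDUCIBLE, status below) — (R1 of ROUTE-P1D §3.2,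
VERBATIM `HodgeNonAV.HC_K3Sq2Type_of_K3Partner`) for X as in the target and a projective K3 surface
S marked by (η, p, x) (the clauses of the tree fact `Surfaces.Huybrechts_K3_marking_exists`), every
ℂ-linear g : H²(S(ℂ);ℂ) → H²(X(ℂ);ℂ) that is a TRANSCENDENTAL HODGE ISOMETRY — (g1) rational ↦
rational, (g2) Hodge types preserved, (g3) g kills N¹(S), (g4) image q-orthogonal to N¹(X), (g5) q(φ
g a, φ g b) = (η a · η b) on cup-transcendental a, b, (g6) onto T(X)_ℂ, (g7) rational transcendental
classes lift rationally — transports the Hodge conjecture: HC 4 (S ⊗ S) → HC 4 X. The LEVER: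
Witt-extend g to a rational Hodge isometry Ψ : H²(S^[2],ℚ) ⥲ H²(X,ℚ), realise Ψ and Ψ⁻¹ by algebraic
classes (Markman, marked fact, both directions), sandwich an algebraic cycle Γ_e on S × S with class
t_{ψ⁻¹eψ} between the Beauville incidence θ ⊂ S × S^[2] and its Fujiki retraction; the composite
acts on H*(X) as a non-zero multiple of t_e, for every self-adjoint e ∈ End_Hdg T(X); Verbitsky Sym²
and `hodgeConjectureFor_four_of_hodgeTwoTwo`-type bookkeeping close degrees ≠ 4. [difficulty: L,
typing only] (status rev 4: every input is a tree theorem or named fact — `WittExtension_holds`;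
`Beauville1983_hilbertSquare_markedIncidence` (S^[2] with its (m1)–(m3) marking and the incidence
class θ); `Markman2024_rationalHodgeIsometry_lift_algebraic_marked` with the PROVED consumer
`….hodgeConjectureFor_iff_K3HilbertSquare` (p485393, commit 92adcf325aed: HC 4 S^[2] ↔ HC 4 X for
marked Hodge-isometric pairs, mod the lift fact + `Voisin2003_cupProduct_algebraicClasses`);
`VerbitskyGuan_cohomology_K3HilbertSquareType` (p467836) for HC 4 S^[2] ⇐ HC 4 (S ⊗ S) through θ ⊠ θ
(Hodge classes of Sym²(T ⊕ N′) = images of (T ⊗ T)^{Hdg} ⊕ Sym² N′; de Cataldo–Migliorini 2002 Thm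
6.2.1 in print) — a known result modulo named facts, so it no longer keys staffing; a (g5)
convention mismatch would make it vacuous, never false; recipe attached as item evidence
PartnerTransport-IsometrySpanned-factreduction-g12.md.) [Markman2024, Beauville1983,
arXiv:alg-geom/9501001, CharlesMarkman2013, Huybrechts2019]
#3 IsometrySpannedThird (support since rev 4: FACT-REDUCIBLE, status below) — (§13 of ROUTE-P1C/P1D,
VERBATIM `HodgeNonAV.HC_K3Sq2Type_of_endos_spanned_by_isometries`) for marked X as in the target: if
every rational, Hodge-type-preserving endomorphism f of H²(X(ℂ);ℂ) that kills N¹(X) and lands in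
T(X)_ℂ agrees on T(X)_ℂ with a ℚ-combination Σ cᵢ gᵢ of bijective rational Hodge-type-preserving
q-ISOMETRIES gᵢ of H², then HC 4 X. Covers the thirds E = ℚ and E CM (unitary elements of a CM field
span it over ℚ: tree theorem `span_setOf_isometry_eq_top_of_conj_ne`), at every Picard rank,
partner-free. [difficulty: L, typing only] (status rev 4: inputs by name — the graphs Zᵢ ⊂ X × X of
the isometries gᵢ are algebraic (`Markman2024_rationalHodgeIsometry_algebraic_marked`; total lift
p485393), H⁴ = Sym² H², b₄ = 276 and q^∨ algebraic (p467836), *_L algebraic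
(`CharlesMarkman2013_lefschetzStandard_K3HilbertType.of_squareType`); DESCENT: ψ = (· ∪ q^∨) : H² →
H⁶ is algebraic with ⟨a, ψ b⟩ = c·q(a, b), c ≠ 0, *_L ∘ ψ ∈ End H² is algebraic and invertible so
its inverse is a ℚ-polynomial in it (Cayley–Hamilton) ⇒ the BBF tensor τ ∈ H² ⊗ H² ⊂ H⁴(X × X)
(acting as c·ψ⁻¹) is algebraic and t_g = δ^*(τ ∘ Zᵍ) modulo the Künneth (0,4)/(4,0) parts,
themselves algebraic (H¹ = H³ = 0); (N ⊗ T)^{Hdg} = 0 and (Sym² T)^{Hdg} = {t_e : e self-adjoint} —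
a known result modulo named facts; same recipe file.) [Markman2024, CharlesMarkman2013,
Zarhin1983HodgeGroupsK3, arXiv:alg-geom/9501001, Buskin2019]
#4 PicardThreeK3Squares (crux) — the Hodge conjecture for the self-product S ⊗ S = S ×_ℂ S of every
projective K3 surface S (marked by (η, p, x) as above) of Picard rank ρ(S) ≥ 3 — the K3-SQUARE
problem restricted to the partners that occur (ρ(S) = ρ(X) − 1 ≥ 3). Known sub-sectors: End_Hdg T(S)
a CM field (Buskin2019 / RamonMari2008; tree fact
`Surfaces.Buskin2019_hodgeConjectureFor_square_of_CM`), End_Hdg T(S) = ℚ (tree THEOREM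
`Summit.HodgeConjecture.HodgeConjecture.Theorems.hodgeConjectureFor_square_of_hodgeEndomorphisms_scalar`),
ρ(S) = 16 (Varesco2025), and the live K3-square items NikulinTwinTransport.SquareHodgeOfSqrtTwo
(stmt-HodgeConjecture-13680) / ELineTransport.RMSquares; OPEN core: real multiplication.
[difficulty: open-problem] (why it might fail: contains HC for S × S with REAL MULTIPLICATION (E =
End_Hdg T(S) totally real ≠ ℚ, e.g. ℚ(√2) at ρ = 16 off Varesco's sector): the graph classes t_e, e
∈ E ∖ ℚ, have no known algebraic source (van Geemen arXiv:math/0609839 §1; Elsenhans–Jahnel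
arXiv:1402.0843 give explicit RM K3s to test on).) [Buskin2019, RamonMari2008, Varesco2025,
Schlickewei2010, arXiv:math/0609839, arXiv:1402.0843, Huybrechts2019]
#5 LowPicardRealMultiplication (crux) — for marked X as in the target whose rational transcendental
Hodge endomorphisms are NOT all spanned by isometries (the real-multiplication third, by Zarhin) and
with ρ(X) = dim N¹(X) ≤ 3, HC 4 X — the PARTNER-FREE RESIDUE: rank T(X) = 23 − ρ ≥ 20, so T(X)_ℚ
embeds in Λ_K3 ⊗ ℚ only under a local (ρ = 3) / global rational (ρ = 2, Huybrechts-type) condition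
and never for ρ = 1, and no K3 surface need carry T(X). [difficulty: open-problem] (why it might
fail: open with NO tool: for E real quadratic acting on T(X) of rank 20–22 nobody has produced t_e
algebraically on any hyper-Kähler fourfold; the very general member of an RM Noether–Lefschetz locus
of K3^[2]-type fourfolds with ρ = 2 is the model counterexample candidate.)
[Zarhin1983HodgeGroupsK3, arXiv:math/0609839, Markman2024, Huybrechts2019, Mongardi2011]
#6 SectorComplement (crux) — the REMAINDER of the summit, claimed by this route as its declared
RESIDUAL component (hub's declared-sector shape, as ELineTransport / NikulinTwinTransport /
EndoscopicMiddleDegree): the Hodge conjecture for all smooth projective varieties beyond the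
K3^[2]-type sector, typed as «target ⇒ summit» so that `closes` concludes the summit statement
itself (D-0027 §2.1). Summit-strength by design (tribunal: `residual: SectorComplement`, counted
once per summit, exempt from T3/T4); the route's attack is on ranks 2–5. [deps: K3Sq2TypeHodge]
[difficulty: open-problem] (why it might fail: it is the Hodge conjecture off one sector — false iff
HC fails anywhere else; no counterexample is known, but the integral and Kähler analogues do fail
(Atiyah–Hirzebruch torsion classes; Voisin 2002 non-algebraic Kähler classes).) [Deligne2000,
VoisinHodgeI2002, Markman2024]
#9 PartnerExistence (support) — (R2 of ROUTE-P1D §3.3,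
`HodgeNonAV.exists_K3Partner_of_picard_ge_four` with ρ(S) ≥ 3 added) for marked X as in the target
with ρ(X) = dim N¹(X) ≥ 4 there exist a projective K3 surface S, a marking (η, p, x) of S, and a
transcendental Hodge isometry g : H²(S(ℂ);ℂ) → H²(X(ℂ);ℂ) with (g1)–(g7), and ρ(S) ≥ 3. Proof plan:
T(X)_ℚ (signature (2, 21 − ρ)) ⊕ N ≅ Λ_K3 ⊗ ℚ for a rational space N of signature (1, ρ − 2) and
dimension ρ − 1 ≥ 3 (Hasse–Minkowski existence + Witt); saturate, take the period ω = image of z,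
apply the surjectivity of the period map in its projective form (tree
`Surfaces.K3PeriodSurjectivity`, N ∋ a positive vector) and read g off the marking; ρ(S) = 22 − rank
T = ρ(X) − 1. [difficulty: M] [Huybrechts2016K3, Morrison1984, Markman2024, arXiv:math/0609839]

TWO-LAYER PLAN. Foreseen glued splits (none filed now): PartnerTransport ⇐ WittExtension (g ↦
rational Hodge isometry H²(S^[2]) ⥲ H²(X) in the marked rendering) → SandwichActsAsGraph (the
Markman–Beauville–Fujiki composite acts as q(h′,h′)·t_e) → PartnerTransport; IsometrySpannedThird ⇐
IsometryGraphOnX (graph of one isometry gives t_g algebraic on X, needs Sym²) → SpanToAll →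
IsometrySpannedThird; PicardThreeK3Squares ⇐ CM ∨ ℚ ∨ RM trichotomy on S (CM: Buskin fact; ℚ: the
kernel theorem; RM: the open child = the K3-square RM problem, shared with
NikulinTwinTransport/ELineTransport by `wanted_by`). General n (R1⁺ via de Cataldo–Migliorini, tree
fact `DecataldoMigliorini2002_hilbertScheme_isDominatedByPowers`) is a later widening, not a child.

KILL CRITERIA. A smooth projective K3^[2]-type fourfold with a non-algebraic rational (2,2)-class
refutes K3Sq2TypeHodge and the summit at once (close refuted:K3Sq2TypeHodge). A projective K3
surface S with ρ(S) ≥ 3 and a non-algebraic Hodge class on S × S refutes PicardThreeK3Squares (and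
HC) — pivot impossible, close. PartnerTransport refuted AS RENDERED (convention mismatch in (g5), or
Sym² failing in the tree's cohomology model) ⇒ misstated-class repair: restate with the corrected
normalisation (PartnerTransportR). PartnerExistence refuted (some T(X)_ℚ with ρ ≥ 4 not embedding in
Λ_ℚ) ⇒ the ρ-threshold moves (restate with the correct bound; the residue crux absorbs the
difference). If HC for K3^[2]-type lands elsewhere (e.g. via
LinearSystemTorelli.MiddleDivisorSupportFourfold's K3SquareTypeSector line) the route is superseded.

NOT DECOMPOSED YET. The facts the provers will consume are NOT items (they would push `closes` past
7 binders and are literature, not theses): F-V Verbitsky–Guan H⁴ = Sym² H² for K3^[2]-type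
(arXiv:alg-geom/9501001; Guan 2001), F-O O'Grady's dual class q^∨ ∈ H^{2,2}(X,ℚ) algebraic (=
(5/6)(c₂ − …); CharlesMarkman2013), S-F polarised Fujiki relation (pure algebra from (m3)), S-W Witt
cancellation / extension over ℚ (Mathlib has `QuadraticForm.equivalent_of_…` only partially), S-C
composition of correspondences in the tree's `corrAction` calculus, F-HM Hasse–Minkowski existence
of a rational form with prescribed local invariants in dimension ≥ 3. They enter as `stub_*` of the
BC3 skeletons and as cite/definition requests below. Also not decomposed: the converse R1⇐ (HC X ⇒
HC(S ⊗ S) for partnered X; informative, not load-bearing), the general-n widening, and the ρ(X) ≤ 3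
residue (no mechanism known — deliberately one crux). STATUS REV 4: F-V and F-O LANDED (p467836:
`VerbitskyGuan_cohomology_K3HilbertSquareType`, `OGrady2008_dualBBFClass_algebraic`,
`cupFour_eq_of_isMarkedK3Hilb`), S-W LANDED
(`Literature.NumberTheory.QuadraticForms.WittExtension_holds`), Markman's total-cohomology lift
LANDED (p485393 `K3HilbertTypeHodgeIsometryLift`), B(X) is the named fact
`CharlesMarkman2013_lefschetzStandard_K3HilbertType`; still untyped: S-F (pure algebra from (m3)),
S-C (partly in the CorrespondenceComposition* files), F-HM (needed only by PartnerExistence).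

CHEAPEST FALSIFIER. (a) CONVENTION CHECK of (g5)/(m3) on S^[2] itself: take X = S^[2] with
Beauville's marked incidence (tree fact `Beauville1983_hilbertSquare_markedIncidence`): the map i =
θ_* restricted to H²(S) must satisfy (g1)–(g7) with the route's exact constants — a one-page
computation a refuter can do in Lean against the two tree facts (if it fails,
PartnerTransport/PartnerExistence are misstated, repairable). (b) LOOKUP: is «HC for S × S, ρ(S) ≥
3» or «HC for K3^[2]-type with ρ ≥ 4» already claimed in print? Searched (Novelty): no — Varesco2025
(ρ = 16 only), Floccari arXiv:2501.02315 (U³-range), Buskin2019 (CM), Markman2024 (no HC corollary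
for fourfolds: in-paper grep «Hodge conjecture» 0 hits, ROUTE-P1D §8). (c) R2 arithmetic: for Fano
varieties of lines F(Y) with ρ = 2 the embedding condition T(X)_ℚ ↪ Λ_ℚ must reproduce Huybrechts'
list of admissible degrees d (associated K3) — a local-symbol computation (< 1 CPU-s; not run,
kit-free seat).

NUMBERS. b₂(X) = 23, b₄(X) = 276 = dim Sym² ℚ²³ (Guan 2001), Fujiki constant c_X = 3, BBF lattice
Λ_K3 ⊕ ⟨−2⟩ of signature (3,20) (Beauville1983); rank T(X) = 23 − ρ(X), signature (2, 21 − ρ);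
partner iff T(X)_ℚ ↪ Λ_K3 ⊗ ℚ (signature (3,19), dim 22) ⇒ guaranteed for ρ(X) ≥ 4 (complement dim ≥
3), conditional for ρ ∈ {2, 3}, impossible for ρ = 1; then ρ(S) = ρ(X) − 1. Known K3-square sectors:
CM (all ρ), E = ℚ (all ρ), ρ(S) = 16 (Varesco2025), ρ(S) ≥ 17 (Shioda–Inose/Morrison1984 + abelian
surfaces), U³ ⊕ ⟨−m⟩ range (Floccari arXiv:2501.02315). Items at open: 7 (target, 4 cruxes, 2
supports). Rev 4: 8 items — target #0, cruxes #4, #5 + residual #6, supports #2, #3, #9, assembly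
#1.

DEFINITION REQUESTS. Cite facts wanted (not blocking the opening; filed as requests after open): F-V
`VerbitskyGuan_H4_eq_symSq_H2` (∀ marked K3^[2]-type X, Sym² H²(X(ℂ);ℂ) → H⁴ is a linear
isomorphism; arXiv:alg-geom/9501001 Thm 1.7 + Guan 2001), F-O O'Grady dual BBF class algebraic
(CharlesMarkman2013 / O'Grady arXiv:1005.3131), F-HM Hasse–Minkowski existence (Serre, Cours
d'arithmétique IV.3.3; Mathlib lacks). Definitions: none needed for the items (all inlined as `let`
heads: MarkedK3Sq, MarkedK3, IsBBFTransc, IsCupTransc, IsK3Partner, SpannedByIsometries); D11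
(Mukai-lattice / total-cohomology carrier for general n) only for the later widening.

Novelty: Searches (2026-08-25, this seat + ROUTE-P1D §8 same day): `lit search --hybrid "rational Hodge
isometries hyper-Kähler K3[n] type algebraic Markman"` (8 docs, textbooks only:
[corpus:book:deligne1982-hodge-cycles-motives-shimura-varieties p.9],
[corpus:book:carlson2017-period-mappings-period-domains p.140]); `lit vsearch "<PartnerTransport in
prose>"` (8 docs, textbooks only); `lit galaxy search "Hodge conjecture for hyperkähler|hyper-Kähler
fourfold of K3|K3^{[2]}-type" --star all` (0 hits in panama/pdf/crabby); `lit galaxy search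
"rational Hodge isometry|transcendental lattice of a hyperkähler|real multiplication K3" --star pdf`
(1: [galaxy:pdf:4691389360] Ancona–Marmora, finite fields); `lit search "Hodge conjecture
hyper-Kähler K3[2]-type fourfold" --source all --year-from 2015` (s2/crossref 15:
[graph:arxiv:2204.00516] Markman2024, [graph:arxiv:2407.19488] Bai 2024 thesis-survey,
[graph:arxiv:2308.04865] Floccari–Varesco (Kummer type), [graph:doi:10.1307/mmj/20236349]
Varesco2025, [graph:arxiv:2406.19361] atomic sheaves); ROUTE-P1D §8: corpus fts «Hodge conjecture
hyperkähler K3^[2] type Hodge isometric motive K3 surface» → [corpus:paper:arxiv-2304.02519] Varesco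
only; galaxy «rational Hodge isometry|Hodge isometric K3|isogenous K3 surfaces» →
[galaxy:pdf:-6776688330456012040] Fu–Vial (derived-equivalence hypotheses),
[graph:doi:10.4171/cmh/465] Huybrechts2019 (n = 1); in-paper grep of arXiv:2204.00516 for «Hodge
conjecture»: 0.
Nearest prior art found: IN THE TREE — (i)  [refs: 10.1307/mmj/20236349, 10.4171/cmh/465, 2204.00516, 2407.19488, 2308.04865, 2406.19361, 2501.02315, book:deligne1982-hodge-cycles-motives-shimura-varieties, book:carlson2017-period-mappings-period-domains, arxiv:2204.00516, arxiv:2407.19488, arxiv:2308.04865, doi:10.1307/mmj/20236349, arxiv:2406.19361, paper:arxiv-2304.02519, doi:10.4171/cmh/465, Markman2024, Varesco2025, Huybrechts2019, Soldatenko]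

Barriers (technique_class: hodge-isometry-transport, lattice-partner, endo-trichotomy): - technique_class: hodge-isometry-transport, hyperholomorphic-markman, lattice-period-partner,
endomorphism-trichotomy
- Literature.Barriers.HodgeConjecture.BlochSrinivas1983_hodgeTypeL0_vanish_of_chowZeroSupported:
outside its technique class (no CH₀-smallness / decomposition of the diagonal / uniruledness is
used); the barrier is WHY a transport lever is needed: h^{2,0}(X) = 1 forbids Bloch–Srinivas /
Conte–Murre methods on hyper-Kählers.
- Literature.Barriers.HodgeConjecture.Clemens1983_griffithsGroup_infiniteRank: outside — no
Abel–Jacobi / normal-function / Lefschetz-pencil step (Zucker's cubic-fourfold method) is used; the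
Fano variety of lines enters only as a K3^[2]-type deformation class, and every statement is about
cohomology classes modulo nothing (HodgeConjectureFor), not about Griffiths groups.
- Literature.Barriers.HodgeConjecture.Andre1996_hodgeClassesOnAbelianVarieties_motivated: outside —
the André road IS available in the tree for K3^[n]-type («Hodge ⇒ motivated»:
`Literature.AlgebraicGeometry.Hyperkaehler.Soldatenkov2022_hodgeClasses_motivated_K3HilbertType_or_kummerType`,
Soldatenkov 2022 Cor. 1.2 + André 1996) but it closes HC only under the Lefschetz standard
conjecture B for ALL smooth projective varieties (`hodgeClasses_algebraic_of_lefschetzStandardB`;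
CorCM `Stage4.hc_K3HilbertType_of_B_of_soldatenkov`) — Charles–Markman's B for K3^[n]-type alone
does not suffice; this route does not pass through motivated classes and its sector statements are
uncon

sub-problem: HodgeConjecture · status: open · opened planner-hodge-nonav-p1-g5-0 2026-08-25T20:14:28Z · rev 5 · ledger route-HodgeConjecture-MarkmanPartnerTransport
GENERATED by the gate from the ledger (D-0016/17). Provers cite these decls: `theorem foo : Summit.HodgeConjecture.HodgeConjecture.Theses.MarkmanPartnerTransport.<Decl> := …` in Summits/HodgeConjecture/HodgeConjecture/Theorems/<Name>.lean.
-/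

namespace Summit.HodgeConjecture.HodgeConjecture.Theses.MarkmanPartnerTransport

open scoped BigOperators Topology Manifold Classical MeasureTheory ProbabilityTheory Matrix InnerProductSpace ComplexConjugate ContinuousMap
open Filter Set Function TopologicalSpace MeasureTheory

attribute [summit_statement] _root_.HodgeConjecture

/-- item stmt-HodgeConjecture-19649 · target · rank 0 · open · by planner
why it might fail: HC for K3^[n]-type is OPEN in print: the (2,2)-classes t_e, e a real-multiplication endomorphism of T(X), have no known algebraic source; a very general RM Noether–Lefschetz member with ρ(X) ≤ 3 is the counterexample candidate (no partner, no isometries).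
sources: Markman2024, arXiv:alg-geom/9501001, Huybrechts2016K3, arXiv:2407.19488
[target] the Hodge conjecture (rational; `HodgeConjectureFor 4 X`) for every smooth projective
fourfold X of K3^[2]-type carrying a marking (φ, P, z) with Markman's clauses (m1)–(m6) (integral
generator P of H⁸, integral lattice read through φ : H²(X(ℂ);ℂ) ≃ ℂ^{Λ_K3 ⊕ ⟨−2⟩}, Fujiki relation
a⁴ = 3 q(a)² P, period z spanning H^{2,0}, H^{1,1} = ⟨z, z̄⟩^⊥, q(z) = 0 < q(z̄, z)); VERBATIM the
cell's `HodgeNonAV.HC_K3Sq2Type_marked` (ROUTE-P1D-Sketch §13). -/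
@[route_item "route-HodgeConjecture-MarkmanPartnerTransport"]
def K3Sq2TypeHodge : Prop :=
  open Literature.AlgebraicGeometry Literature.AlgebraicGeometry.Motives Literature.AlgebraicGeometry.HodgeTheory Literature.AlgebraicGeometry.Hyperkaehler Literature.AlgebraicGeometry.Surfaces Literature.AlgebraicTopology.SingularHomology CategoryTheory in let MarkedK3Sq := fun (X : SchemeOver ℂ) (φ : complexBetti X 2 ≃ₗ[ℂ] (K3HilbertIndex → ℂ)) (P : complexBetti X (2 * 4)) (z : K3HilbertIndex → ℂ) => ((IsIntegralClass P ∧ ∀ Q : complexBetti X (2 * 4), IsIntegralClass Q → ∃ n : ℤ, Q = n • P) ∧ (∀ c : complexBetti X 2, IsIntegralClass c ↔ ∃ v : K3HilbertIndex → ℤ, φ c = fun i => (v i : ℂ)) ∧ (∀ a : complexBetti X 2, cupPowTwo a 4 = ((3 : ℂ) * (k3HilbertForm 2 (φ a) (φ a)) ^ 2) • P) ∧ (IsOfHodgeType 4 X 2 2 0 (LinearEquiv.symm φ z) ∧ ∀ τ : complexBetti X 2, IsOfHodgeType 4 X 2 2 0 τ → ∃ t : ℂ, τ = t • LinearEquiv.symm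 φ z) ∧ (∀ c : complexBetti X 2, IsOfHodgeType 4 X 2 1 1 c ↔ (k3HilbertForm 2 (φ c) z = 0 ∧ k3HilbertForm 2 (φ c) (star z) = 0)) ∧ (k3HilbertForm 2 z z = 0 ∧ 0 < (k3HilbertForm 2 (star z) z).re)); ∀ (X : SchemeOver ℂ), IsSmoothProjective 4 X → IsOfK3HilbertSquareType X → ∀ (φ : complexBetti X 2 ≃ₗ[ℂ] (K3HilbertIndex → ℂ)) (P : complexBetti X (2 * 4)) (z : K3HilbertIndex → ℂ), MarkedK3Sq X φ P z → HodgeConjectureFor 4 X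

/-- item stmt-HodgeConjecture-19652 · crux · rank 4 · open · by planner
why it might fail: RM K3 squares: an algebraic source for a generator t∈E∖ℚ is in print only for the six vGS families (tree: VanGeemenSchuett2025_rmK3_cycleInduced_*; then HC⁴(S⊗S) = IsCycleInducedRMK3.hodgeConjectureFor_tensor_self_of mod stub F4) and Kuga–Satake slices; general maximal-RM member: none known.
sources: Buskin2019, RamonMari2008, Varesco2025, Schlickewei2010, arXiv:math/0609839, arXiv:1402.0843
[crux] the Hodge conjecture for the self-product S ⊗ S = S ×_ℂ S of every projective K3 surface S
(marked by (η, p, x) as above) of Picard rank ρ(S) ≥ 3 — the K3-SQUARE problem restricted to the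
partners that occur (ρ(S) = ρ(X) − 1 ≥ 3). Known sub-sectors: End_Hdg T(S) a CM field (Buskin2019 /
RamonMari2008; tree fact `Surfaces.Buskin2019_hodgeConjectureFor_square_of_CM`), End_Hdg T(S) = ℚ
(tree THEOREM
`Summit.HodgeConjecture.HodgeConjecture.Theorems.hodgeConjectureFor_square_of_hodgeEndomorphisms_scalar`),
ρ(S) = 16 (Varesco2025), and the live K3-square items NikulinTwinTransport.SquareHodgeOfSqrtTwo
(stmt-HodgeConjecture-13680) / ELineTransport.RMSquares; OPEN core: real multiplication.
[difficulty: open-problem] -/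
@[route_item "route-HodgeConjecture-MarkmanPartnerTransport", crux]
def PicardThreeK3Squares : Prop :=
  open Literature.AlgebraicGeometry Literature.AlgebraicGeometry.Motives Literature.AlgebraicGeometry.HodgeTheory Literature.AlgebraicGeometry.Hyperkaehler Literature.AlgebraicGeometry.Surfaces Literature.AlgebraicTopology.SingularHomology CategoryTheory in let MarkedK3 := fun (S : SchemeOver ℂ) (η : complexBetti S (2 * 1) ≃ₗ[ℂ] (K3Index → ℂ)) (p : complexBetti S (2 * 2)) (x : K3Index → ℂ) => p ≠ 0 ∧ (IsIntegralClass p ∧ (∀ q : complexBetti S (2 * 2), IsIntegralClass q → ∃ n : ℤ, q = n • p) ∧ (∀ c : complexBetti S (2 * 1), IsIntegralClass c ↔ ∃ v : K3Index → ℤ, η c = fun i => (v i : ℂ)) ∧ (∀ a b : complexBetti S (2 * 1), cupProduct (rfl : 2 * 1 + 2 * 1 = 2 * 2) a b = k3Form (η a) (η b) • p) ∧ IsOfHodgeType 2 S (2 * 1) 2 0 (LinearEquiv.symm η x) ∧ (∀ τ : complexBetti S (2 * 1), IsOfHodgeType 2 S (2 * 1) 2 0 τ → ∃ t : ℂ,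 τ = t • LinearEquiv.symm η x)) ∧ (k3Form x x = 0 ∧ 0 < (k3Form (star x) x).re ∧ ∃ u : K3Index → ℤ, k3Form (fun i => (u i : ℂ)) x = 0 ∧ 0 < ∑ i, ∑ j, u i * k3Gram i j * u j); ∀ (S : SchemeOver ℂ), IsK3Surface S → ∀ (η : complexBetti S (2 * 1) ≃ₗ[ℂ] (K3Index → ℂ)) (p : complexBetti S (2 * 2)) (x : K3Index → ℂ), MarkedK3 S η p x → 3 ≤ Module.finrank ℂ ↥(algebraicClasses S 1) → HodgeConjectureFor 4 (MonoidalCategoryStruct.tensorObj S S)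

/-- item stmt-HodgeConjecture-19653 · crux · rank 5 · open · by planner
why it might fail: Regime NON-VACUOUS by tree fact VanGeemenSchuett2025_exists_rmK3_realQuadratic_picardTwo: X=S^[2], S the ρ=2 real-quadratic RM K3, has ρ(X)=3, End_Hdg T(X)=E, Hodge isometries of T = ±1 only; no algebraic source for t_e on any HK fourfold in print — model counterexample candidate.
sources: Zarhin1983HodgeGroupsK3, arXiv:math/0609839, Markman2024, Huybrechts2019, Mongardi2011, arXiv:2310.05196
[crux] for marked X as in the target whose rational transcendental Hodge endomorphisms are NOT all
spanned by isometries (the real-multiplication third, by Zarhin) and with ρ(X) = dim N¹(X) ≤ 3, HC 4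
X — the PARTNER-FREE RESIDUE: rank T(X) = 23 − ρ ≥ 20, so T(X)_ℚ embeds in Λ_K3 ⊗ ℚ only under a
local (ρ = 3) / global rational (ρ = 2, Huybrechts-type) condition and never for ρ = 1, and no K3
surface need carry T(X). [difficulty: open-problem] -/
@[route_item "route-HodgeConjecture-MarkmanPartnerTransport", crux]
def LowPicardRealMultiplication : Prop :=
  open Literature.AlgebraicGeometry Literature.AlgebraicGeometry.Motives Literature.AlgebraicGeometry.HodgeTheory Literature.AlgebraicGeometry.Hyperkaehler Literature.AlgebraicGeometry.Surfaces Literature.AlgebraicTopology.SingularHomology CategoryTheory in let MarkedK3Sq := fun (X : SchemeOver ℂ) (φ : complexBetti X 2 ≃ₗ[ℂ] (K3HilbertIndex → ℂ)) (P : complexBetti X (2 * 4)) (z : K3HilbertIndex → ℂ) => ((IsIntegralClass P ∧ ∀ Q : complexBetti X (2 * 4), IsIntegralClass Q → ∃ n : ℤ, Q = n • P) ∧ (∀ c : complexBetti X 2, IsIntegralClass c ↔ ∃ v : K3HilbertIndex → ℤ, φ c = fun i => (v i : ℂ)) ∧ (∀ a : complexBetti X 2, cupPowTwo a 4 = ((3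 : ℂ) * (k3HilbertForm 2 (φ a) (φ a)) ^ 2) • P) ∧ (IsOfHodgeType 4 X 2 2 0 (LinearEquiv.symm φ z) ∧ ∀ τ : complexBetti X 2, IsOfHodgeType 4 X 2 2 0 τ → ∃ t : ℂ, τ = t • LinearEquiv.symm φ z) ∧ (∀ c : complexBetti X 2, IsOfHodgeType 4 X 2 1 1 c ↔ (k3HilbertForm 2 (φ c) z = 0 ∧ k3HilbertForm 2 (φ c) (star z) = 0)) ∧ (k3HilbertForm 2 z z = 0 ∧ 0 < (k3HilbertForm 2 (star z) z).re)); let IsBBFTransc := fun (X : SchemeOver ℂ) (φ : complexBetti X 2 ≃ₗ[ℂ] (K3HilbertIndex → ℂ)) (y : complexBetti X 2) => ∀ d : complexBetti X 2, d ∈ algebraicClasses X 1 → k3HilbertForm 2 (φ y) (φ d) = 0; let SpannedByIsometries := fun (X : SchemeOver ℂ) (φ : complexBetti X 2 ≃ₗ[ℂ] (K3HilbertIndex → ℂ)) => ∀ f : complexBetti X 2 →ₗ[ℂ] complexBetti X 2, (∀ y, IsRationalClass y → IsRationalClass (f y)) → (∀ (i j : ℕ) y, IsOfHodgeType 4 X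 2 i j y → IsOfHodgeType 4 X 2 i j (f y)) → (∀ d : complexBetti X 2, d ∈ algebraicClasses X 1 → f d = 0) → (∀ y : complexBetti X 2, IsBBFTransc X φ (f y)) → ∃ (k : ℕ) (c : Fin k → ℚ) (g : Fin k → (complexBetti X 2 →ₗ[ℂ] complexBetti X 2)), (∀ i, Function.Bijective (g i) ∧ (∀ y, IsRationalClass y → IsRationalClass (g i y)) ∧ (∀ (a b : ℕ) y, IsOfHodgeType 4 X 2 a b y → IsOfHodgeType 4 X 2 a b (g i y)) ∧ (∀ a b, k3HilbertForm 2 (φ (g i a)) (φ (g i b)) = k3HilbertForm 2 (φ a) (φ b))) ∧ ∀ y : complexBetti X 2, IsBBFTransc X φ y → f y = ∑ i : Fin k, ((c i : ℂ) • g i y); ∀ (X : SchemeOver ℂ), IsSmoothProjective 4 X → IsOfK3HilbertSquareType X → ∀ (φ : complexBetti X 2 ≃ₗ[ℂ] (K3HilbertIndex → ℂ)) (P : complexBetti X (2 * 4)) (z : K3HilbertIndex → ℂ), MarkedK3Sq X φ P z → ¬ SpannedByIsometries X φ → Module.finrank ℂ ↥(algebraicClasses X 1) ≤ 3 → HodgeConjectureFor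 4 X

/-- item stmt-HodgeConjecture-19654 · crux · rank 6 · open · by planner
why it might fail: it is the Hodge conjecture off one sector — false iff HC fails anywhere else; no counterexample is known, but the integral and Kähler analogues do fail (Atiyah–Hirzebruch torsion classes; Voisin 2002 non-algebraic Kähler classes).
sources: Deligne2000, VoisinHodgeI2002, Markman2024
[crux] the REMAINDER of the summit, claimed by this route as its declared RESIDUAL component (hub's
declared-sector shape, as ELineTransport / NikulinTwinTransport / EndoscopicMiddleDegree): the Hodge
conjecture for all smooth projective varieties beyond the K3^[2]-type sector, typed as «target ⇒
summit» so that `closes` concludes the summit statement itself (D-0027 §2.1). Summit-strength by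
design (tribunal: `residual: SectorComplement`, counted once per summit, exempt from T3/T4); the
route's attack is on ranks 2–5. [deps: K3Sq2TypeHodge] [difficulty: open-problem] -/
@[route_item "route-HodgeConjecture-MarkmanPartnerTransport", crux]
def SectorComplement : Prop :=
  K3Sq2TypeHodge → _root_.HodgeConjecture

/-- item stmt-HodgeConjecture-19650 · support · rank 2 · open · by planner
why it might fail: Sym²H²=H⁴, q^∨ algebraic, polarised Fujiki are tree facts now (VerbitskyGuan_cohomology_K3HilbertSquareType, OGrady2008_dualBBFClass_algebraic, cupFour_eq_of_isMarkedK3Hilb); left: θ-retraction constants r∘i = q(h′,h′) on T(S), and the (g5) k3Form/k3HilbertForm convention (mismatch ⇒ vacuous).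
sources: Markman2024, Beauville1983, arXiv:alg-geom/9501001, DecataldoMigliorini2002, Huybrechts2019, OGrady2008NumericalK3Square
[crux] (R1 of ROUTE-P1D §3.2, VERBATIM `HodgeNonAV.HC_K3Sq2Type_of_K3Partner`) for X as in the
target and a projective K3 surface S marked by (η, p, x) (the clauses of the tree fact
`Surfaces.Huybrechts_K3_marking_exists`), every ℂ-linear g : H²(S(ℂ);ℂ) → H²(X(ℂ);ℂ) that is a
TRANSCENDENTAL HODGE ISOMETRY — (g1) rational ↦ rational, (g2) Hodge types preserved, (g3) g kills
N¹(S), (g4) image q-orthogonal to N¹(X), (g5) q(φ g a, φ g b) = (η a · η b) on cup-transcendental a,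
b, (g6) onto T(X)_ℂ, (g7) rational transcendental classes lift rationally — transports the Hodge
conjecture: HC 4 (S ⊗ S) → HC 4 X. The LEVER: Witt-extend g to a rational Hodge isometry Ψ :
H²(S^[2],ℚ) ⥲ H²(X,ℚ), realise Ψ and Ψ⁻¹ by algebraic classes (Markman, marked fact, both
directions), sandwich an algebraic cycle Γ_e on S × S with class t_{ψ⁻¹eψ} between the Beauville
incidence θ ⊂ S × S^[2] and its Fujiki retraction; the composite acts on H*(X) as a non-zero
multiple of t_e, for every self-adjoint e ∈ End_Hdg T(X); Verbitsky Sym² and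
`hodgeConjectureFor_four_of_hodgeTwoTwo`-type bookkeeping close degrees ≠ 4. [difficulty: L] -/
@[route_item "route-HodgeConjecture-MarkmanPartnerTransport", crux]
def PartnerTransport : Prop :=
  open Literature.AlgebraicGeometry Literature.AlgebraicGeometry.Motives Literature.AlgebraicGeometry.HodgeTheory Literature.AlgebraicGeometry.Hyperkaehler Literature.AlgebraicGeometry.Surfaces Literature.AlgebraicTopology.SingularHomology CategoryTheory in let MarkedK3Sq := fun (X : SchemeOver ℂ) (φ : complexBetti X 2 ≃ₗ[ℂ] (K3HilbertIndex → ℂ)) (P : complexBetti X (2 * 4)) (z : K3HilbertIndex → ℂ) => ((IsIntegralClass P ∧ ∀ Q : complexBetti X (2 * 4), IsIntegralClass Q → ∃ n : ℤ, Q = n • P) ∧ (∀ c : complexBetti X 2, IsIntegralClass c ↔ ∃ v : K3HilbertIndex → ℤ, φ c = fun i => (v i : ℂ)) ∧ (∀ a : complexBetti X 2, cupPowTwo a 4 = ((3 : ℂ) * (k3HilbertForm 2 (φ a) (φ a)) ^ 2) • P) ∧ (IsOfHodgeType 4 X 2 2 0 (LinearEquiv.symm φ z) ∧ ∀ τ :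 complexBetti X 2, IsOfHodgeType 4 X 2 2 0 τ → ∃ t : ℂ, τ = t • LinearEquiv.symm φ z) ∧ (∀ c : complexBetti X 2, IsOfHodgeType 4 X 2 1 1 c ↔ (k3HilbertForm 2 (φ c) z = 0 ∧ k3HilbertForm 2 (φ c) (star z) = 0)) ∧ (k3HilbertForm 2 z z = 0 ∧ 0 < (k3HilbertForm 2 (star z) z).re)); let IsBBFTransc := fun (X : SchemeOver ℂ) (φ : complexBetti X 2 ≃ₗ[ℂ] (K3HilbertIndex → ℂ)) (y : complexBetti X 2) => ∀ d : complexBetti X 2, d ∈ algebraicClasses X 1 → k3HilbertForm 2 (φ y) (φ d) = 0; let MarkedK3 := fun (S : SchemeOver ℂ) (η : complexBetti S (2 * 1) ≃ₗ[ℂ] (K3Index → ℂ)) (p : complexBetti S (2 * 2)) (x : K3Index → ℂ) => p ≠ 0 ∧ (IsIntegralClass p ∧ (∀ q : complexBetti S (2 * 2), IsIntegralClass q → ∃ n : ℤ, q = n • p) ∧ (∀ c : complexBetti S (2 * 1), IsIntegralClass c ↔ ∃ v : K3Index → ℤ, η c = fun i => (v i : ℂ)) ∧ (∀ a b : complexBetti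 S (2 * 1), cupProduct (rfl : 2 * 1 + 2 * 1 = 2 * 2) a b = k3Form (η a) (η b) • p) ∧ IsOfHodgeType 2 S (2 * 1) 2 0 (LinearEquiv.symm η x) ∧ (∀ τ : complexBetti S (2 * 1), IsOfHodgeType 2 S (2 * 1) 2 0 τ → ∃ t : ℂ, τ = t • LinearEquiv.symm η x)) ∧ (k3Form x x = 0 ∧ 0 < (k3Form (star x) x).re ∧ ∃ u : K3Index → ℤ, k3Form (fun i => (u i : ℂ)) x = 0 ∧ 0 < ∑ i, ∑ j, u i * k3Gram i j * u j); let IsCupTransc := fun (S : SchemeOver ℂ) (a : complexBetti S (2 * 1)) => ∀ d ∈ algebraicClasses S 1, cupProduct (rfl : 2 * 1 + 2 * 1 = 2 * 2) a d = 0; let IsK3Partner := fun (S : SchemeOver ℂ) (η : complexBetti S (2 * 1) ≃ₗ[ℂ] (K3Index → ℂ)) (X : SchemeOver ℂ) (φ : complexBetti X 2 ≃ₗ[ℂ] (K3HilbertIndex → ℂ)) (g : complexBetti S (2 * 1) →ₗ[ℂ] complexBetti X 2) => (∀ a, IsRationalClass a → IsRationalClass (g a)) ∧ (∀ (i j : ℕ)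 a, IsOfHodgeType 2 S (2 * 1) i j a → IsOfHodgeType 4 X 2 i j (g a)) ∧ (∀ d ∈ algebraicClasses S 1, g d = 0) ∧ (∀ a, IsBBFTransc X φ (g a)) ∧ (∀ a b, IsCupTransc S a → IsCupTransc S b → k3HilbertForm 2 (φ (g a)) (φ (g b)) = k3Form (η a) (η b)) ∧ (∀ y, IsBBFTransc X φ y → ∃ a, IsCupTransc S a ∧ g a = y) ∧ (∀ y, IsBBFTransc X φ y → IsRationalClass y → ∃ a, IsCupTransc S a ∧ IsRationalClass a ∧ g a = y); ∀ (X : SchemeOver ℂ), IsSmoothProjective 4 X → IsOfK3HilbertSquareType X → ∀ (φ : complexBetti X 2 ≃ₗ[ℂ] (K3HilbertIndex → ℂ)) (P : complexBetti X (2 * 4)) (z : K3HilbertIndex → ℂ), MarkedK3Sq X φ P z → ∀ (S : SchemeOver ℂ), IsK3Surface S → ∀ (η : complexBetti S (2 * 1) ≃ₗ[ℂ] (K3Index → ℂ)) (p : complexBetti S (2 * 2)) (x : K3Index → ℂ), MarkedK3 S η p x → ∀ (g : complexBetti S (2 * 1) →ₗ[ℂ] complexBetti X 2), IsK3Partner S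 η X φ g → HodgeConjectureFor 4 (MonoidalCategoryStruct.tensorObj S S) → HodgeConjectureFor 4 X

/-- item stmt-HodgeConjecture-19651 · support · rank 3 · open · by planner
why it might fail: Sym² step by name now: b₄=276, H⁴=⟨a∪b⟩ (VerbitskyGuan_cohomology_K3HilbertSquareType), q^∨ algebraic (OGrady2008_dualBBFClass_algebraic); left: Markman2024 Thm 1.1 makes graph(g) ⊂ X×X algebraic for Hodge ISOMETRIES only — descent of Σcᵢ·graph(gᵢ)|_{T⊗T} to t_f on X (ℚ-linear κ, Sym²NS correction).
sources: Markman2024, CharlesMarkman2013, Zarhin1983HodgeGroupsK3, arXiv:alg-geom/9501001, Buskin2019, OGrady2008NumericalK3Square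
[crux] (§13 of ROUTE-P1C/P1D, VERBATIM `HodgeNonAV.HC_K3Sq2Type_of_endos_spanned_by_isometries`) for
marked X as in the target: if every rational, Hodge-type-preserving endomorphism f of H²(X(ℂ);ℂ)
that kills N¹(X) and lands in T(X)_ℂ agrees on T(X)_ℂ with a ℚ-combination Σ cᵢ gᵢ of bijective
rational Hodge-type-preserving q-ISOMETRIES gᵢ of H², then HC 4 X. Covers the thirds E = ℚ and E CM
(unitary elements of a CM field span it over ℚ: tree theorem
`span_setOf_isometry_eq_top_of_conj_ne`), at every Picard rank, partner-free. [difficulty: L] -/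
@[route_item "route-HodgeConjecture-MarkmanPartnerTransport", crux]
def IsometrySpannedThird : Prop :=
  open Literature.AlgebraicGeometry Literature.AlgebraicGeometry.Motives Literature.AlgebraicGeometry.HodgeTheory Literature.AlgebraicGeometry.Hyperkaehler Literature.AlgebraicGeometry.Surfaces Literature.AlgebraicTopology.SingularHomology CategoryTheory in let MarkedK3Sq := fun (X : SchemeOver ℂ) (φ : complexBetti X 2 ≃ₗ[ℂ] (K3HilbertIndex → ℂ)) (P : complexBetti X (2 * 4)) (z : K3HilbertIndex → ℂ) => ((IsIntegralClass P ∧ ∀ Q : complexBetti X (2 * 4), IsIntegralClass Q → ∃ n : ℤ, Q = n • P) ∧ (∀ c : complexBetti X 2, IsIntegralClass c ↔ ∃ v : K3HilbertIndex → ℤ, φ c = fun i => (v i : ℂ)) ∧ (∀ a : complexBetti X 2, cupPowTwo a 4 = ((3 : ℂ) * (k3HilbertForm 2 (φ a) (φ a)) ^ 2) • P) ∧ (IsOfHodgeType 4 X 2 2 0 (LinearEquiv.symm φ z) ∧ ∀ τ : complexBetti X 2, IsOfHodgeType 4 X 2 2 0 τ → ∃ t : ℂ, τ = t • LinearEquiv.symm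 φ z) ∧ (∀ c : complexBetti X 2, IsOfHodgeType 4 X 2 1 1 c ↔ (k3HilbertForm 2 (φ c) z = 0 ∧ k3HilbertForm 2 (φ c) (star z) = 0)) ∧ (k3HilbertForm 2 z z = 0 ∧ 0 < (k3HilbertForm 2 (star z) z).re)); let IsBBFTransc := fun (X : SchemeOver ℂ) (φ : complexBetti X 2 ≃ₗ[ℂ] (K3HilbertIndex → ℂ)) (y : complexBetti X 2) => ∀ d : complexBetti X 2, d ∈ algebraicClasses X 1 → k3HilbertForm 2 (φ y) (φ d) = 0; let SpannedByIsometries := fun (X : SchemeOver ℂ) (φ : complexBetti X 2 ≃ₗ[ℂ] (K3HilbertIndex → ℂ)) => ∀ f : complexBetti X 2 →ₗ[ℂ] complexBetti X 2, (∀ y, IsRationalClass y → IsRationalClass (f y)) → (∀ (i j : ℕ) y, IsOfHodgeType 4 X 2 i j y → IsOfHodgeType 4 X 2 i j (f y)) → (∀ d : complexBetti X 2, d ∈ algebraicClasses X 1 → f d = 0) → (∀ y : complexBetti X 2, IsBBFTransc X φ (f y)) → ∃ (k : ℕ) (c : Fin k → ℚ) (g : Fin k → (complexBetti X 2 →ₗ[ℂ]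 complexBetti X 2)), (∀ i, Function.Bijective (g i) ∧ (∀ y, IsRationalClass y → IsRationalClass (g i y)) ∧ (∀ (a b : ℕ) y, IsOfHodgeType 4 X 2 a b y → IsOfHodgeType 4 X 2 a b (g i y)) ∧ (∀ a b, k3HilbertForm 2 (φ (g i a)) (φ (g i b)) = k3HilbertForm 2 (φ a) (φ b))) ∧ ∀ y : complexBetti X 2, IsBBFTransc X φ y → f y = ∑ i : Fin k, ((c i : ℂ) • g i y); ∀ (X : SchemeOver ℂ), IsSmoothProjective 4 X → IsOfK3HilbertSquareType X → ∀ (φ : complexBetti X 2 ≃ₗ[ℂ] (K3HilbertIndex → ℂ)) (P : complexBetti X (2 * 4)) (z : K3HilbertIndex → ℂ), MarkedK3Sq X φ P z → SpannedByIsometries X φ → HodgeConjectureFor 4 X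

/-- item stmt-HodgeConjecture-19655 · support · rank 9 · open · by planner
sources: Huybrechts2016K3, Morrison1984, Markman2024, arXiv:math/0609839
[support] (R2 of ROUTE-P1D §3.3, `HodgeNonAV.exists_K3Partner_of_picard_ge_four` with ρ(S) ≥ 3
added) for marked X as in the target with ρ(X) = dim N¹(X) ≥ 4 there exist a projective K3 surface
S, a marking (η, p, x) of S, and a transcendental Hodge isometry g : H²(S(ℂ);ℂ) → H²(X(ℂ);ℂ) with
(g1)–(g7), and ρ(S) ≥ 3. Proof plan: T(X)_ℚ (signature (2, 21 − ρ)) ⊕ N ≅ Λ_K3 ⊗ ℚ for a rational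
space N of signature (1, ρ − 2) and dimension ρ − 1 ≥ 3 (Hasse–Minkowski existence + Witt);
saturate, take the period ω = image of z, apply the surjectivity of the period map in its projective
form (tree `Surfaces.K3PeriodSurjectivity`, N ∋ a positive vector) and read g off the marking; ρ(S)
= 22 − rank T = ρ(X) − 1. [difficulty: M] -/
@[route_item "route-HodgeConjecture-MarkmanPartnerTransport", crux]
def PartnerExistence : Prop :=
  open Literature.AlgebraicGeometry Literature.AlgebraicGeometry.Motives Literature.AlgebraicGeometry.HodgeTheory Literature.AlgebraicGeometry.Hyperkaehler Literature.AlgebraicGeometry.Surfaces Literature.AlgebraicTopology.SingularHomology CategoryTheory in let MarkedK3Sq := fun (X : SchemeOver ℂ) (φ : complexBetti X 2 ≃ₗ[ℂ] (K3HilbertIndex → ℂ)) (P : complexBetti X (2 * 4)) (z : K3HilbertIndex → ℂ) => ((IsIntegralClass P ∧ ∀ Q : complexBetti X (2 * 4), IsIntegralClass Q → ∃ n : ℤ, Q = n • P) ∧ (∀ c : complexBetti X 2, IsIntegralClass c ↔ ∃ v : K3HilbertIndex → ℤ, φ c = fun i => (v i : ℂ)) ∧ (∀ a : complexBetti X 2,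 cupPowTwo a 4 = ((3 : ℂ) * (k3HilbertForm 2 (φ a) (φ a)) ^ 2) • P) ∧ (IsOfHodgeType 4 X 2 2 0 (LinearEquiv.symm φ z) ∧ ∀ τ : complexBetti X 2, IsOfHodgeType 4 X 2 2 0 τ → ∃ t : ℂ, τ = t • LinearEquiv.symm φ z) ∧ (∀ c : complexBetti X 2, IsOfHodgeType 4 X 2 1 1 c ↔ (k3HilbertForm 2 (φ c) z = 0 ∧ k3HilbertForm 2 (φ c) (star z) = 0)) ∧ (k3HilbertForm 2 z z = 0 ∧ 0 < (k3HilbertForm 2 (star z) z).re)); let IsBBFTransc := fun (X : SchemeOver ℂ) (φ : complexBetti X 2 ≃ₗ[ℂ] (K3HilbertIndex → ℂ)) (y : complexBetti X 2) => ∀ d : complexBetti X 2, d ∈ algebraicClasses X 1 → k3HilbertForm 2 (φ y) (φ d) = 0; let MarkedK3 := fun (S : SchemeOver ℂ) (η : complexBetti S (2 * 1) ≃ₗ[ℂ] (K3Index → ℂ)) (p : complexBetti S (2 * 2)) (x : K3Index → ℂ) => p ≠ 0 ∧ (IsIntegralClass p ∧ (∀ q : complexBetti S (2 * 2), IsIntegralClass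 q → ∃ n : ℤ, q = n • p) ∧ (∀ c : complexBetti S (2 * 1), IsIntegralClass c ↔ ∃ v : K3Index → ℤ, η c = fun i => (v i : ℂ)) ∧ (∀ a b : complexBetti S (2 * 1), cupProduct (rfl : 2 * 1 + 2 * 1 = 2 * 2) a b = k3Form (η a) (η b) • p) ∧ IsOfHodgeType 2 S (2 * 1) 2 0 (LinearEquiv.symm η x) ∧ (∀ τ : complexBetti S (2 * 1), IsOfHodgeType 2 S (2 * 1) 2 0 τ → ∃ t : ℂ, τ = t • LinearEquiv.symm η x)) ∧ (k3Form x x = 0 ∧ 0 < (k3Form (star x) x).re ∧ ∃ u : K3Index → ℤ, k3Form (fun i => (u i : ℂ)) x = 0 ∧ 0 < ∑ i, ∑ j, u i * k3Gram i j * u j); let IsCupTransc := fun (S : SchemeOver ℂ) (a : complexBetti S (2 * 1)) => ∀ d ∈ algebraicClasses S 1, cupProduct (rfl : 2 * 1 + 2 * 1 = 2 * 2) a d = 0; let IsK3Partner := fun (S : SchemeOver ℂ) (η : complexBetti S (2 * 1) ≃ₗ[ℂ] (K3Index → ℂ)) (X : SchemeOver ℂ) (φ : complexBetti X 2 ≃ₗ[ℂ]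 (K3HilbertIndex → ℂ)) (g : complexBetti S (2 * 1) →ₗ[ℂ] complexBetti X 2) => (∀ a, IsRationalClass a → IsRationalClass (g a)) ∧ (∀ (i j : ℕ) a, IsOfHodgeType 2 S (2 * 1) i j a → IsOfHodgeType 4 X 2 i j (g a)) ∧ (∀ d ∈ algebraicClasses S 1, g d = 0) ∧ (∀ a, IsBBFTransc X φ (g a)) ∧ (∀ a b, IsCupTransc S a → IsCupTransc S b → k3HilbertForm 2 (φ (g a)) (φ (g b)) = k3Form (η a) (η b)) ∧ (∀ y, IsBBFTransc X φ y → ∃ a, IsCupTransc S a ∧ g a = y) ∧ (∀ y, IsBBFTransc X φ y → IsRationalClass y → ∃ a, IsCupTransc S a ∧ IsRationalClass a ∧ g a = y); ∀ (X : SchemeOver ℂ), IsSmoothProjective 4 X → IsOfK3HilbertSquareType X → ∀ (φ : complexBetti X 2 ≃ₗ[ℂ] (K3HilbertIndex → ℂ)) (P : complexBetti X (2 * 4)) (z : K3HilbertIndex → ℂ), MarkedK3Sq X φ P z → 4 ≤ Module.finrank ℂ ↥(algebraicClasses X 1) → ∃ (S : SchemeOver ℂ) (η : complexBetti S (2 *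 1) ≃ₗ[ℂ] (K3Index → ℂ)) (p : complexBetti S (2 * 2)) (x : K3Index → ℂ) (g : complexBetti S (2 * 1) →ₗ[ℂ] complexBetti X 2), IsK3Surface S ∧ MarkedK3 S η p x ∧ IsK3Partner S η X φ g ∧ 3 ≤ Module.finrank ℂ ↥(algebraicClasses S 1)

/-- item stmt-HodgeConjecture-19656 · assembly · rank 1 · closed · proved by Summit.HodgeConjecture.HodgeConjecture.Theorems.markmanPartnerTransport_assembly_proof (prover) · by planner
sources: Markman2024, Zarhin1983HodgeGroupsK3
[assembly] PartnerTransport → IsometrySpannedThird → PicardThreeK3Squares →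
LowPicardRealMultiplication → PartnerExistence → SectorComplement → the Hodge conjecture (pure
logic: the trichotomy case split of § Assembly). -/
@[route_item "route-HodgeConjecture-MarkmanPartnerTransport"]
def Assembly : Prop :=
  PartnerTransport → IsometrySpannedThird → PicardThreeK3Squares → LowPicardRealMultiplication → PartnerExistence → SectorComplement → _root_.HodgeConjecture

-- `Assembly` holds: proved by `Summit.HodgeConjecture.HodgeConjecture.Theorems.markmanPartnerTransport_assembly_proof` (its module imports this route file, so no `_holds` link can be stated here).

/-! D-0027 §2.1 — DECIDING THEOREM (planner-authored via `route open/edit --closes-file`; by planner-hodge-nonav-p1-g5-0 2026-08-25T20:14:29Z):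
its hypotheses are this route's items and its conclusion the sub-problem Statement (glue_lint), and it elaborates with this file. -/

@[closes "route-HodgeConjecture-MarkmanPartnerTransport"] theorem closes (h₂ : PartnerTransport) (h₃ : IsometrySpannedThird) (h₄ : PicardThreeK3Squares)
    (h₅ : LowPicardRealMultiplication) (h₆ : PartnerExistence) (hC : SectorComplement) :
    _root_.HodgeConjecture := by
  refine hC ?_
  intro X hX hK φ P z hM
  by_cases hsp : (open Literature.AlgebraicGeometry.Motives Literature.AlgebraicGeometry.HodgeTheory
      Literature.AlgebraicGeometry.Hyperkaehler in
    ∀ f : complexBetti X 2 →ₗ[ℂ] complexBetti X 2, (∀ y, IsRationalClass y → IsRationalClass (f y)) →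
      (∀ (i j : ℕ) y, IsOfHodgeType 4 X 2 i j y → IsOfHodgeType 4 X 2 i j (f y)) →
      (∀ d : complexBetti X 2, d ∈ algebraicClasses X 1 → f d = 0) →
      (∀ y : complexBetti X 2, ∀ d : complexBetti X 2, d ∈ algebraicClasses X 1 → k3HilbertForm 2 (φ (f y)) (φ d) = 0) →
      ∃ (k : ℕ) (c : Fin k → ℚ) (g : Fin k → (complexBetti X 2 →ₗ[ℂ] complexBetti X 2)),
        (∀ i, Function.Bijective (g i) ∧ (∀ y, IsRationalClass y → IsRationalClass (g i y)) ∧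
          (∀ (a b : ℕ) y, IsOfHodgeType 4 X 2 a b y → IsOfHodgeType 4 X 2 a b (g i y)) ∧
          (∀ a b, k3HilbertForm 2 (φ (g i a)) (φ (g i b)) = k3HilbertForm 2 (φ a) (φ b))) ∧
        ∀ y : complexBetti X 2, (∀ d : complexBetti X 2, d ∈ algebraicClasses X 1 → k3HilbertForm 2 (φ y) (φ d) = 0) →
          f y = ∑ i : Fin k, ((c i : ℂ) • g i y))
  · exact h₃ X hX hK φ P z hM hsp
  · by_cases hρ : 4 ≤ Module.finrank ℂ ↥(Literature.AlgebraicGeometry.HodgeTheory.algebraicClasses X 1)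
    · obtain ⟨S, η, p, x, g, hS, hSm, hg, hρS⟩ := h₆ X hX hK φ P z hM hρ
      exact h₂ X hX hK φ P z hM S hS η p x hSm g hg (h₄ S hS η p x hSm hρS)
    · exact h₅ X hX hK φ P z hM hsp (by omega)

end Summit.HodgeConjecture.HodgeConjecture.Theses.MarkmanPartnerTransport
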